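import Summits.HodgeConjecture.HodgeConjecture.Theorems.Q8SymplecticPowersPowersHodgeOfQuaternionCommutators
import Summits.HodgeConjecture.HodgeConjecture.Theorems.Q8SymplecticPowersRegularAt
import HarnessLib

/-!
# Route `Q8SymplecticPowers`: the new-cases leaf `Q8SurfacePowersHodge` from the ONE open crux K1Q (K2Q is a tree theorem), pointwise in `e`;
# the `e = 4` new cases from (Z_b)₄ ∧ LCERT₄ ∧ CDK ∧ Deligne 1987

Route `HodgeConjecture/Q8SymplecticPowers` (target item stmt-HodgeConjecture-24189 `Q8SurfacePowersHodge`, crux K1Q stmt-HodgeConjecture-24190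
`VeryGeneralQuaternionCommutatorsInHg`). Helper (`--supports stmt-HodgeConjecture-24190 --as helper`; nothing here closes an item; no
definition; the two print inputs CDK ∕ Deligne 1987 enter only the last theorem, as hypotheses).

The route's deciding theorem `Theses.Q8SymplecticPowers.closes` feeds K1Q and K2Q `PowersHodgeOfQuaternionCommutators` into the target and
then the declared residual. K2Q is PROVED in the tree (`Q8SymplecticPowersPowersHodgeOfQuaternionCommutators.powersHodgeOfQuaternionCommutators`),
so the new-cases leaf hangs on K1Q alone; and the passage is fibrewise in `e`:

* `q8SurfacePowersHodge_of_K1Q` — `VeryGeneralQuaternionCommutatorsInHg → Q8SurfacePowersHodge` BY NAME (K2Q supplied by its tree proof).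
* `surfacePowersHodge_at_of_K1Q_at` — for each `e`: the crux body at `e` gives the leaf body at `e`.
* `surfacePowersHodge_at_four_of_residues` — **the `e = 4` new cases** («for the very general quaternionic quartic double plane
  `x₃⁴x₂⁸ = c(σc)³((x₀−x₁)ψ)²`, `deg ψ = 3`, every smooth model `X` with a cohomological quaternion pair has `HodgeConjectureFor` on ALL
  self-powers `X^{k+1}`») from exactly: (Z_b)₄ [a Zariski-dense set of Betti-regular members at `e = 4`], the registered member certificate
  LCERT₄, and the print inputs CDK 1995, Deligne 1987 Prop 1.13 (via p811761 `K1Q_at_four_of_dense_bettiRegularMembers`).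

Honest scope: compositions over landed theorems; (Z_b)₄, LCERT₄, CDK, Deligne 1987, K1Q, `Q8SurfacePowersHodge` and HC are NOT proved here.
-/

set_option linter.dupNamespace false
set_option maxHeartbeats 800000

noncomputable section

namespace Summit.HodgeConjecture.HodgeConjecture.Theorems.Q8SymplecticPowersSurfacePowersHodgeOfK1Q

open Summit.HodgeConjecture.HodgeConjecture.Theses.Q8SymplecticPowers (VeryGeneralQuaternionCommutatorsInHg PowersHodgeOfQuaternionCommutators Q8SurfacePowersHodge)
open CategoryTheory CategoryTheory.Limits AlgebraicGeometry
open Literature.AlgebraicGeometry.Motives Literature.AlgebraicGeometry.HodgeTheory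
open Literature.AlgebraicGeometry.HodgeTheory.BettiUniverse Literature.AlgebraicGeometry.HodgeTheory.Q8Family

/-- **The crux body at `e` gives the leaf body at `e`** (the route's deciding composition, fibrewise in `e`, with K2Q
`PowersHodgeOfQuaternionCommutators` supplied by its tree proof). [cite: Deligne1980, §2] [cite: Andre1992, §5 Thm. 1] -/
theorem surfacePowersHodge_at_of_K1Q_at :
    open Literature.AlgebraicGeometry.Motives Literature.AlgebraicGeometry.HodgeTheory Literature.AlgebraicGeometry.HodgeTheory.BettiUniverse Literature.AlgebraicGeometry.HodgeTheory.Q8Family Literature.AlgebraicGeometry.RelativeSpec Literature.AlgebraicGeometry.RelativeSpec.ActionOver Literature.Algebra.Lie Literature.Algebra.Lie.KatzRecognition CategoryTheory CategoryTheory.Limits MonoidalCategory CartesianMonoidalCategory AlgebraicGeometry in let Uni : (X : SchemeOver ℂ) → IsSmoothProjective 2 X → (X ⟶ X) → (X ⟶ X) → (bettiCohomology X 2 ≃ₗ[ℚ] bettiCohomology X 2) → Prop := fun X hX τ j g => (∀ x, g (pull τ 2 x) = pull τ 2 (g x)) ∧ (∀ x, g (pull j 2 x) = pull j 2 (g x))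 ∧ (∀ x y, tr hX (2 + 2) (cup X 2 2 (g x) (g y)) = tr hX (2 + 2) (cup X 2 2 x y)) ∧ ∀ x ∈ (hodge exists_isReal_hodgeModel_holds hX 2).hodgeClasses 1, g x = x; let Comm : (X : SchemeOver ℂ) → IsSmoothProjective 2 X → (X ⟶ X) → (X ⟶ X) → Prop := fun X hX τ j => haveI := finite hX 2; haveI : HodgeTensorFacts.{0, 0} := hodgeTensorFacts_holds; ∀ g h : bettiCohomology X 2 ≃ₗ[ℚ] bettiCohomology X 2, Uni X hX τ j g → Uni X hX τ j h → g * h * g⁻¹ * h⁻¹ ∈ (hodge exists_isReal_hodgeModel_holds hX 2).hodgeGroup; ∀ ⦃e : ℕ⦄, (∃ G : ℕ → MvPolynomial ({d : Fin 3 →₀ ℕ // d.degree = 1} ⊕ {d : Fin 3 →₀ ℕ // d.degree = e - 1}) ℂ, (∀ i, ∃ c ψ : MvPolynomial (Fin 3) ℂ, c.IsHomogeneous 1 ∧ ψ.IsHomogeneous (e - 1) ∧ MvPolynomial.rename (Equiv.swap (0 : Fin 3) 1) ψ = ψ ∧ MvPolynomial.eval (Sum.elim (fun d => c.coeff d.1)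 (fun d => ψ.coeff d.1)) (G i) ≠ 0) ∧ ∀ c ψ : MvPolynomial (Fin 3) ℂ, c.IsHomogeneous 1 → ψ.IsHomogeneous (e - 1) → MvPolynomial.rename (Equiv.swap (0 : Fin 3) 1) ψ = ψ → (∀ i, MvPolynomial.eval (Sum.elim (fun d => c.coeff d.1) (fun d => ψ.coeff d.1)) (G i) ≠ 0) → ∀ ⦃V X : SchemeOver ℂ⦄ (hX : IsSmoothProjective 2 X), IsHypersurfaceCutOutBy 3 (MvPolynomial.X (Fin.last 3) ^ 4 * MvPolynomial.X (Fin.castSucc 2) ^ (2 * e) - MvPolynomial.rename Fin.castSucc (c * MvPolynomial.rename (Equiv.swap (0 : Fin 3) 1) c ^ 3 * ((MvPolynomial.X 0 - MvPolynomial.X 1) * ψ) ^ 2)) V → AlgebraicGeometry.Scheme.BirationalOver X.hom V.hom → Module.finrank ℚ (bettiCohomology X 1) = 0 ∧ ∀ τ j : X ⟶ X, (pull τ 2 ^ 4 = 1 ∧ pull j 2 ^ 2 = pull τ 2 ^ 2 ∧ pull j 2 * pull τ 2 = pull τ 2 ^ 3 * pull j 2 ∧ Module.finrank ℂ ↥(Module.End.eigenspace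 ((pull τ 2 ^ 2).baseChange ℂ) 1 ⊓ (hodge exists_isReal_hodgeModel_holds hX 2).piece 2 0) = 0 ∧ 0 < Module.finrank ℂ ↥(Module.End.eigenspace ((pull τ 2 ^ 2).baseChange ℂ) (-1) ⊓ (hodge exists_isReal_hodgeModel_holds hX 2).piece 2 0)) → Comm X hX τ j) → ∃ G : ℕ → MvPolynomial ({d : Fin 3 →₀ ℕ // d.degree = 1} ⊕ {d : Fin 3 →₀ ℕ // d.degree = e - 1}) ℂ, (∀ i, ∃ c ψ : MvPolynomial (Fin 3) ℂ, c.IsHomogeneous 1 ∧ ψ.IsHomogeneous (e - 1) ∧ MvPolynomial.rename (Equiv.swap (0 : Fin 3) 1) ψ = ψ ∧ MvPolynomial.eval (Sum.elim (fun d => c.coeff d.1) (fun d => ψ.coeff d.1)) (G i) ≠ 0) ∧ ∀ c ψ : MvPolynomial (Fin 3) ℂ, c.IsHomogeneous 1 → ψ.IsHomogeneous (e - 1) → MvPolynomial.rename (Equiv.swap (0 : Fin 3) 1) ψ = ψ → (∀ i, MvPolynomial.eval (Sum.elim (fun d => c.coeff d.1) (fun d => ψ.coeff d.1)) (G i) ≠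 0) → ∀ ⦃V X : SchemeOver ℂ⦄ (hX : IsSmoothProjective 2 X), IsHypersurfaceCutOutBy 3 (MvPolynomial.X (Fin.last 3) ^ 4 * MvPolynomial.X (Fin.castSucc 2) ^ (2 * e) - MvPolynomial.rename Fin.castSucc (c * MvPolynomial.rename (Equiv.swap (0 : Fin 3) 1) c ^ 3 * ((MvPolynomial.X 0 - MvPolynomial.X 1) * ψ) ^ 2)) V → AlgebraicGeometry.Scheme.BirationalOver X.hom V.hom → ∀ τ j : X ⟶ X, (pull τ 2 ^ 4 = 1 ∧ pull j 2 ^ 2 = pull τ 2 ^ 2 ∧ pull j 2 * pull τ 2 = pull τ 2 ^ 3 * pull j 2 ∧ Module.finrank ℂ ↥(Module.End.eigenspace ((pull τ 2 ^ 2).baseChange ℂ) 1 ⊓ (hodge exists_isReal_hodgeModel_holds hX 2).piece 2 0) = 0 ∧ 0 < Module.finrank ℂ ↥(Module.End.eigenspace ((pull τ 2 ^ 2).baseChange ℂ) (-1) ⊓ (hodge exists_isReal_hodgeModel_holds hX 2).piece 2 0)) → ∀ ⦃k : ℕ⦄ ⦃Y : SchemeOver ℂ⦄, (∃ π : Fin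 (k + 1) → (Y ⟶ X), Nonempty (IsLimit (Fan.mk Y π))) → HodgeConjectureFor (2 * (k + 1)) Y := by
  intro Uni Comm e h₁
  obtain ⟨G, hG₀, hG⟩ := h₁
  refine ⟨G, hG₀, ?_⟩
  intro c ψ hc hψ hinv hgen V X hX hcut hbir τ j hdeck k Y hY
  obtain ⟨hb1, hcomm⟩ := hG c ψ hc hψ hinv hgen hX hcut hbir
  exact Summit.HodgeConjecture.HodgeConjecture.Theorems.Q8SymplecticPowersPowersHodgeOfQuaternionCommutators.powersHodgeOfQuaternionCommutators
    hX hb1 τ j hdeck (hcomm τ j hdeck) hY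

/-- **The new-cases leaf from the one open crux**: `VeryGeneralQuaternionCommutatorsInHg → Q8SurfacePowersHodge` by name (K2Q is the tree
theorem `powersHodgeOfQuaternionCommutators`). [cite: Deligne1980, §2] [cite: Andre1992, §5 Thm. 1] -/
theorem q8SurfacePowersHodge_of_K1Q (h₁ : VeryGeneralQuaternionCommutatorsInHg) : Q8SurfacePowersHodge := by
  intro e he h4
  exact surfacePowersHodge_at_of_K1Q_at (h₁ he h4)

/-- **The `e = 4` new cases of the leaf from (Z_b)₄, LCERT₄, CDK, Deligne 1987**: a Zariski-dense set of Betti-regular quartic planes at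
`e = 4`, the registered member local certificate at `e = 4`, and the two print inputs give `HodgeConjectureFor (2(k+1))` on every self fibre
power of every smooth model with a cohomological quaternion pair, for very general `(c, ψ)` with `deg ψ = 3` (composition of p811761 with
`surfacePowersHodge_at_of_K1Q_at`). [cite: CattaniDeligneKaplan1995, Thm. 1.1 and Cor. 1.2] [cite: Deligne1987, Prop. 1.13] -/
theorem surfacePowersHodge_at_four_of_residues
    (HZ : ∀ g : ParamRing 4, g ≠ 0 → ∃ a : CIdx 4 → ℂ, MvPolynomial.eval a g ≠ 0 ∧
      MvPolynomial.eval a (genericityElem 4) ≠ 0 ∧ ∃ (X₀ : SchemeOver ℂ) (_ : IsSmoothProjective 2 X₀),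
        AlgebraicGeometry.Scheme.BirationalOver X₀.hom (fiberSch 4 (MvPolynomial.eval a)).hom ∧
          Module.finrank ℚ (bettiCohomology X₀ 1) = 0)
    (h₉₄ : open Literature.AlgebraicGeometry.Motives Literature.AlgebraicGeometry.HodgeTheory Literature.AlgebraicGeometry.HodgeTheory.BettiUniverse Literature.AlgebraicGeometry.HodgeTheory.Q8Family Literature.AlgebraicGeometry.RelativeSpec Literature.AlgebraicGeometry.RelativeSpec.ActionOver CategoryTheory CategoryTheory.Limits MonoidalCategory CartesianMonoidalCategory AlgebraicGeometry Literature.AlgebraicTopology.SingularHomology in ∀ ⦃e : ℕ⦄, e = 4 → ∃ (W : (Spec (.of (ParamRing e))).Opens) (𝒳 : SchemeOver ℂ) (π : 𝒳 ⟶ base W) (τ j : 𝒳 ⟶ 𝒳) (ι : (deckChart (fun i => (MvPolynomial.X i : ParamRing e)) ⊗ Over.mk W.ι).left ⟶ 𝒳.left), ∃ (_ : Nonempty (ComplexPoints (base W))) (hπ : IsSmoothProjectiveFamily π 2) (_ : IsQuasiProjectiveOver 𝒳) (_ : IsQuasiProjectiveOver (base W)) (_ : AlgebraicGeometry.SmoothOfRelativeDimension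 (Fintype.card (CIdx e)) (base W).hom) (hτπ : τ ≫ π = π) (hjπ : j ≫ π = π) (_ : τ ≫ τ ≫ τ ≫ τ = 𝟙 𝒳) (_ : j ≫ j = τ ≫ τ) (_ : τ ≫ j ≫ τ = j) (_ : IsOpenImmersion ι) (_ : ι ≫ π.left = (snd (deckChart (fun i => (MvPolynomial.X i : ParamRing e))) (Over.mk W.ι)).left) (_ : ((Over.isoMk ((deckAction (fun i => (MvPolynomial.X i : ParamRing e))).aut (QuaternionGroup.a 1)) ((deckAction (fun i => (MvPolynomial.X i : ParamRing e))).aut_comp (QuaternionGroup.a 1))).hom ▷ Over.mk W.ι).left ≫ ι = ι ≫ τ.left) (_ : ((Over.isoMk ((deckAction (fun i => (MvPolynomial.X i : ParamRing e))).aut (QuaternionGroup.xa 0)) ((deckAction (fun i => (MvPolynomial.X i : ParamRing e))).aut_comp (QuaternionGroup.xa 0))).hom ▷ Over.mk W.ι).left ≫ ι = ι ≫ j.left) (_ : Function.Surjective (snd (deckChart (fun i => (MvPolynomial.X i : ParamRing e))) (Over.mk W.ι)).left), ∀ (hU : IsCohomologicallyLocallyTrivialOn π Set.univ), ∃ (b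 : ComplexPoints (base W)) (ψ : OpenPartialHomeomorph (Set.univ : Set (ComplexPoints (base W))) (Fin (Fintype.card (CIdx e)) → ℂ)) (W₀ : Set (Set.univ : Set (ComplexPoints (base W)))) (ω : (Fin (Fintype.card (CIdx e)) → ℂ) → TensorProduct ℚ ℂ (bettiCohomology (fiberOver π b) 2)) (r : ℕ), IsOpen W₀ ∧ (⟨b, Set.mem_univ b⟩ : (Set.univ : Set (ComplexPoints (base W)))) ∈ W₀ ∧ W₀ ⊆ ψ.source ∧ (let Xb := fiberOver π b; let hXb : IsSmoothProjective 2 Xb := hπ.isSmoothProjective b; let Ab : bettiCohomology Xb 2 →ₗ[ℚ] bettiCohomology Xb 2 := pull (fiberOverEnd π τ hτπ b) 2; let Mb : Submodule ℂ (TensorProduct ℚ ℂ (bettiCohomology Xb 2)) := Module.End.eigenspace (Ab.baseChange ℂ) Complex.I; Module.finrank ℂ ↥(Module.End.eigenspace ((Ab ^ 2).baseChange ℂ) 1 ⊓ (hodge exists_isReal_hodgeModel_holds hXb 2).piece 2 0) = 0 ∧ 0 < Module.finrank ℂ ↥(Module.End.eigenspace ((Ab ^ 2).baseChange ℂ) (-1)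 ⊓ (hodge exists_isReal_hodgeModel_holds hXb 2).piece 2 0) ∧ 6 ≤ Module.finrank ℂ ↥Mb ∧ Module.finrank ℂ ↥(Mb ⊓ (hodge exists_isReal_hodgeModel_holds hXb 2).F 2) ≤ 1 ∧ (∀ t ∈ W₀, ∀ (ε : Path (⟨b, Set.mem_univ b⟩ : (Set.univ : Set (ComplexPoints (base W)))) t), (∀ r', ε r' ∈ W₀) → ∀ (T : bettiCohomology Xb 2 ≃ₗ[ℚ] bettiCohomology (fiberOver π t.1) 2), (∀ v, ofRatClass _ 2 (T v) = transportFun π 2 hU ⟦ε⟧ (ofRatClass _ 2 v)) → ω (ψ t) ∈ Mb ⊓ ((hodge exists_isReal_hodgeModel_holds (hπ.isSmoothProjective t.1) 2).comapEquiv T).F 2) ∧ (∀ φ : Module.Dual ℂ (TensorProduct ℚ ℂ (bettiCohomology Xb 2)), (∀ i ≤ r, iteratedFDeriv ℂ i (fun z ↦ φ (ω z)) (ψ ⟨b, Set.mem_univ b⟩) = 0) → ∀ m ∈ Mb, φ m = 0)) ∧ ∃ (γ : bettiCohomology (fiberOver π b) 2 ≃ₗ[ℚ] bettiCohomology (fiberOver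 π b) 2), γ ∈ ratMonodromyGroup π 2 hU ⟨b, Set.mem_univ b⟩ ∧ (∃ a, pull (fiberOverEnd π τ hτπ b) 2 (pull (fiberOverEnd π τ hτπ b) 2 a) = -a ∧ γ a ≠ a) ∧ ∃ (h : ComplexPoints (fiberOver π b) ≃ₜ ComplexPoints (fiberOver π b)), (∀ a, γ a = (singularCohomology.map ℚ ℚ (h : C(ComplexPoints (fiberOver π b), ComplexPoints (fiberOver π b))) 2).hom a) ∧ singularHomology.map ℚ ℚ (h : C(ComplexPoints (fiberOver π b), ComplexPoints (fiberOver π b))) 4 (complexOrientationRat (hπ.isSmoothProjective b)).fundamentalClass = (complexOrientationRat (hπ.isSmoothProjective b)).fundamentalClass ∧ (∀ x, h ((AlgPoints.mapContinuous (L := ℂ) (fiberOverEnd π τ hτπ b)) x) = (AlgPoints.mapContinuous (L := ℂ) (fiberOverEnd π τ hτπ b)) (h x)) ∧ ∃ (A₁ A₂ B : Set (ComplexPoints (fiberOver π b))), IsOpen A₁ ∧ IsOpen A₂ ∧ IsOpen B ∧ A₁ ∪ A₂ ∪ B = Set.univ ∧ Disjoint (closure A₁) A₂ ∧ (∀ x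 ∈ B, h x = x) ∧ ∃ (hhA₁ : Set.MapsTo (h : C(ComplexPoints (fiberOver π b), ComplexPoints (fiberOver π b))) A₁ A₁) (hhA₂ : Set.MapsTo (h : C(ComplexPoints (fiberOver π b), ComplexPoints (fiberOver π b))) A₂ A₂) (hτA₁ : Set.MapsTo (AlgPoints.mapContinuous (L := ℂ) (fiberOverEnd π τ hτπ b)) A₁ A₁) (hτA₂ : Set.MapsTo (AlgPoints.mapContinuous (L := ℂ) (fiberOverEnd π τ hτπ b)) A₂ A₂) (_ : Set.MapsTo (AlgPoints.mapContinuous (L := ℂ) (fiberOverEnd π j hjπ b)) A₁ A₂) (_ : Set.MapsTo (AlgPoints.mapContinuous (L := ℂ) (fiberOverEnd π j hjπ b)) A₂ A₁) (_ : Module.Finite ℚ (singularHomology ℚ ℚ (↥A₁) 2)) (_ : Module.Finite ℚ (singularHomology ℚ ℚ (↥A₂) 2)), Module.finrank ℚ ↥(Module.End.eigenspace ((singularHomology.map ℚ ℚ (singularHomology.restrictSelf (AlgPoints.mapContinuous (L := ℂ) (fiberOverEnd π τ hτπ b)) hτA₁) 2).hom ^ 2) (-1 : ℚ)) ≤ 2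 ∧ (∀ a : singularHomology ℚ ℚ (↥A₁) 2, singularHomology.map ℚ ℚ (singularHomology.restrictSelf (AlgPoints.mapContinuous (L := ℂ) (fiberOverEnd π τ hτπ b)) hτA₁) 2 (singularHomology.map ℚ ℚ (singularHomology.restrictSelf (AlgPoints.mapContinuous (L := ℂ) (fiberOverEnd π τ hτπ b)) hτA₁) 2 a) = -a → singularHomology.map ℚ ℚ (singularHomology.restrictSelf (h : C(ComplexPoints (fiberOver π b), ComplexPoints (fiberOver π b))) hhA₁) 2 a = singularHomology.map ℚ ℚ (singularHomology.restrictSelf (AlgPoints.mapContinuous (L := ℂ) (fiberOverEnd π τ hτπ b)) hτA₁) 2 a) ∧ (∀ a : singularHomology ℚ ℚ (↥A₂) 2, singularHomology.map ℚ ℚ (singularHomology.restrictSelf (AlgPoints.mapContinuous (L := ℂ) (fiberOverEnd π τ hτπ b)) hτA₂) 2 (singularHomology.map ℚ ℚ (singularHomology.restrictSelf (AlgPoints.mapContinuous (L := ℂ) (fiberOverEnd π τ hτπ b)) hτA₂) 2 a) = -a → singularHomology.map ℚ ℚ (singularHomology.restrictSelf (h : C(ComplexPoints (fiberOver π b), ComplexPoints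 (fiberOver π b))) hhA₂) 2 (singularHomology.map ℚ ℚ (singularHomology.restrictSelf (AlgPoints.mapContinuous (L := ℂ) (fiberOverEnd π τ hτπ b)) hτA₂) 2 a) = a))
    (hcdk : open Literature.AlgebraicGeometry.HodgeTheory in cmsp_nonHodgeGenericPoints_countable_algebraic_cover)
    (hdel : Literature.AlgebraicGeometry.HodgeTheory.deligne1987_monodromy_directSum_irreducible_subvariations) :
    open Literature.AlgebraicGeometry.Motives Literature.AlgebraicGeometry.HodgeTheory Literature.AlgebraicGeometry.HodgeTheory.BettiUniverse CategoryTheory.Limits in ∀ ⦃e : ℕ⦄, e = 4 → ∃ G : ℕ → MvPolynomial ({d : Fin 3 →₀ ℕ // d.degree = 1} ⊕ {d : Fin 3 →₀ ℕ // d.degree = e - 1}) ℂ, (∀ i, ∃ c ψ : MvPolynomial (Fin 3) ℂ, c.IsHomogeneous 1 ∧ ψ.IsHomogeneous (e - 1) ∧ MvPolynomial.rename (Equiv.swap (0 : Fin 3) 1) ψ = ψ ∧ MvPolynomial.eval (Sum.elim (fun d => c.coeff d.1) (fun d => ψ.coeff d.1)) (G i) ≠ 0) ∧ ∀ c ψ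 : MvPolynomial (Fin 3) ℂ, c.IsHomogeneous 1 → ψ.IsHomogeneous (e - 1) → MvPolynomial.rename (Equiv.swap (0 : Fin 3) 1) ψ = ψ → (∀ i, MvPolynomial.eval (Sum.elim (fun d => c.coeff d.1) (fun d => ψ.coeff d.1)) (G i) ≠ 0) → ∀ ⦃V X : SchemeOver ℂ⦄ (hX : IsSmoothProjective 2 X), IsHypersurfaceCutOutBy 3 (MvPolynomial.X (Fin.last 3) ^ 4 * MvPolynomial.X (Fin.castSucc 2) ^ (2 * e) - MvPolynomial.rename Fin.castSucc (c * MvPolynomial.rename (Equiv.swap (0 : Fin 3) 1) c ^ 3 * ((MvPolynomial.X 0 - MvPolynomial.X 1) * ψ) ^ 2)) V → AlgebraicGeometry.Scheme.BirationalOver X.hom V.hom → ∀ τ j : X ⟶ X, (pull τ 2 ^ 4 = 1 ∧ pull j 2 ^ 2 = pull τ 2 ^ 2 ∧ pull j 2 * pull τ 2 = pull τ 2 ^ 3 * pull j 2 ∧ Module.finrank ℂ ↥(Module.End.eigenspace ((pull τ 2 ^ 2).baseChange ℂ) 1 ⊓ (hodge exists_isReal_hodgeModel_holds hX 2).piece 2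 0) = 0 ∧ 0 < Module.finrank ℂ ↥(Module.End.eigenspace ((pull τ 2 ^ 2).baseChange ℂ) (-1) ⊓ (hodge exists_isReal_hodgeModel_holds hX 2).piece 2 0)) → ∀ ⦃k : ℕ⦄ ⦃Y : SchemeOver ℂ⦄, (∃ π : Fin (k + 1) → (Y ⟶ X), Nonempty (IsLimit (Fan.mk Y π))) → HodgeConjectureFor (2 * (k + 1)) Y := by
  intro e he4
  exact surfacePowersHodge_at_of_K1Q_at
    (Q8SymplecticPowersRegularAt.K1Q_at_four_of_dense_bettiRegularMembers HZ h₉₄ @hcdk @hdel he4)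

end Summit.HodgeConjecture.HodgeConjecture.Theorems.Q8SymplecticPowersSurfacePowersHodgeOfK1Q

end
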